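import Literature.Probability.RandomPlanarGeometry.SLERestrictionSmooth
import Literature.Probability.RandomPlanarGeometry.LoewnerHullHittingArc
import HarnessLib

/-!
# [LSW] Lemma 6.3, the claim: the image of a normal path under `g_T` approaches `W_T` inside a sector

Decomposition of the named fact
`Literature.Probability.RandomPlanarGeometry.IsSmoothHull.restrictionDerivVanishesAtHit`
(**[LSW] Lemma 6.3**, file `SLERestrictionSmooth`), after

* G. F. Lawler, O. Schramm, W. Werner, *Conformal restriction: the chordal case*, J. Amer. Math.
  Soc. **16** (2003) 917–955, arXiv:math/0209343 (**[LSW]**), proof of Lemma 6.3 (p. 14 of the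
  arXiv version).

The printed proof runs: (¶1) "the rather obvious fact `K_T ∩ A ⊂ ∂A`" — PROVED in the tree for
Jordan arc hulls (`Loewner.IsHullHitTime.closedHull_inter_subset_frontier`,
`Loewner.IsHullHitTime.exists_mem_frontier_swallowingTime_eq` of `LoewnerHullHittingArc`);
(¶2) "Let `z₀` be some point in `∂A ∩ K_T`. Let `β : [0,1] → ℍ` be a smooth path such that
`β[0,1)` is contained in the interior of `A`, `β(1) = z₀`, and `β'(1)` is orthogonal to `∂A` at
`z₀`"; (¶3) "**We claim that `β̂(x) := g_T ∘ β(x) − W_T`, `x ∈ [0,1)`, is a path which is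
contained in a sector `|Re z| ≤ c Im z` for some `c`. As in the proof of Lemma 6.2, we know that
`lim_{x ↗ 1} β̂(x) = W_T`** [i.e. `g_T ∘ β(x) → W_T`]" — proved in print by a two-sided Brownian
hitting estimate at `z₀` ("By smoothness of `A ∩ ℍ`, there is some small disk `D ⊂ ℍ` with
center `z₀` such that `D ∩ A` consists of exactly two points [sic: arcs] …") and conformal
invariance of planar Brownian motion, resp. by boundary correspondence along curves
[Pommerenke, *Boundary behaviour of conformal maps*] and an ODE argument; (¶4) the conclusion
via the Brownian excursion and Prop. 4.1.

This file VENDORS the two halves of the claim (¶3) as named facts, in the vocabulary of the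
tree (`Loewner.map W τ` = `g_T`, `Loewner.closedHull`, `Loewner.IsHullHitTime`,
`Loewner.swallowingTime`; the smooth hulls `IsSmoothHull` of `SLERestrictionSmooth`, unbundled
as `IsSmoothHullWith A γ γ'` so that "orthogonal to `∂A` at `z₀ = γ(s₀)`" refers to the tangent
`γ'(s₀)` of the given regular `C¹` parametrisation):

* `IsSmoothHitPath A γ γ' s₀ β β'` — the data of ¶2: `β` is `C¹` on `[0, 1]` with derivative
  `β'`, `β'(1) ≠ 0`, `β[0,1) ⊆ interior A`, `β(1) = γ(s₀)` and `β'(1) ⊥ γ'(s₀)`;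
* `IsSmoothHull.hitPath_tendsto` — NAMED FACT: `g_T(β(x)) − W_T → 0` as `x ↗ 1`;
* `IsSmoothHull.hitPath_stolz` — NAMED FACT: `|Re (g_T(β(x)) − W_T)| ≤ c Im (g_T(β(x)) − W_T)`
  for all `x ∈ [0, 1)`, for some `c`.

In both, `g_T(β(x)) = Loewner.map W τ (β x)` is a genuine value of the Loewner map: points of
`interior A` are still flowing at time `τ` (`Loewner.IsHullHitTime.lt_swallowingTime_of_mem_interior`,
proved; recorded below as `IsSmoothHitPath.lt_swallowingTime`). The hypotheses are those of
Lemma 6.3: `W` continuous, `A ∈ 𝒬*` smooth, `τ = T` the hitting time of `A` by the closed hulls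
with `K_T ∩ A ∩ ℝ = ∅` (no real point of `A` swallowed by time `τ`), `z₀ = γ(s₀) ∈ ∂A ∩ K_T`.
-/

noncomputable section

open Set Filter Metric Complex
open _root_.Topology
open UpperHalfPlane (upperHalfPlaneSet isOpen_upperHalfPlaneSet)
open scoped NNReal ComplexConjugate

namespace Literature.Probability.RandomPlanarGeometry

variable {A : Set ℂ}

/-! ### Smooth hulls with a named parametrisation; normal hit paths -/

/-- **Smooth hull with a given parametrisation of its boundary arc**: the clauses of
`IsSmoothHull A` ([LSW] §2 p. 8, "smooth hull") for the specific regular `C¹` arc `γ` with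
derivative `γ'` — `A ∈ 𝒬`, `γ` has derivative `γ' t ≠ 0` within `[0, 1]` at every `t ∈ [0, 1]`,
`γ'` continuous on `[0, 1]`, `γ` injective on `[0, 1]`, `γ(0), γ(1) ∈ ℝ`, `γ(0,1) ⊂ ℍ`, and
`ℍ ∩ ∂A = γ(0,1)`. By definition `IsSmoothHull A ↔ ∃ γ γ', IsSmoothHullWith A γ γ'`
(`isSmoothHull_iff`). [cite: LawlerSchrammWerner2003Restriction, §2 p. 8 (smooth hulls)] -/
def IsSmoothHullWith (A : Set ℂ) (γ γ' : ℝ → ℂ) : Prop :=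
  IsBoundedHull A ∧ (∀ t ∈ Icc (0 : ℝ) 1, HasDerivWithinAt γ (γ' t) (Icc 0 1) t) ∧
    ContinuousOn γ' (Icc 0 1) ∧ (∀ t ∈ Icc (0 : ℝ) 1, γ' t ≠ 0) ∧ InjOn γ (Icc 0 1) ∧
    (γ 0).im = 0 ∧ (γ 1).im = 0 ∧ (∀ t ∈ Ioo (0 : ℝ) 1, 0 < (γ t).im) ∧
    upperHalfPlaneSet ∩ frontier A = γ '' Ioo 0 1

/-- `IsSmoothHull` unbundled. [folklore] -/
theorem isSmoothHull_iff : IsSmoothHull A ↔ ∃ γ γ' : ℝ → ℂ, IsSmoothHullWith A γ γ' := by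
  constructor
  · rintro ⟨hA, γ, γ', h⟩
    exact ⟨γ, γ', hA, h⟩
  · rintro ⟨γ, γ', hA, h⟩
    exact ⟨hA, γ, γ', h⟩

/-- A smooth hull with a named parametrisation is a smooth hull. [folklore] -/
theorem IsSmoothHullWith.isSmoothHull {γ γ' : ℝ → ℂ} (h : IsSmoothHullWith A γ γ') :
    IsSmoothHull A :=
  isSmoothHull_iff.2 ⟨γ, γ', h⟩

/-- Interior parameters give points of the open boundary arc `ℍ ∩ ∂A`. [folklore] -/
theorem IsSmoothHullWith.apply_mem_frontier {γ γ' : ℝ → ℂ} (h : IsSmoothHullWith A γ γ') {s : ℝ}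
    (hs : s ∈ Ioo (0 : ℝ) 1) : γ s ∈ upperHalfPlaneSet ∩ frontier A := by
  rw [h.2.2.2.2.2.2.2.2]
  exact mem_image_of_mem γ hs

/-- **A smooth path into `A` ending orthogonally on `∂A` at `z₀ = γ(s₀)`** ([LSW] proof of
Lemma 6.3, ¶2: "Let `β : [0,1] → ℍ` be a smooth path such that `β[0,1)` is contained in the
interior of `A`, `β(1) = z₀`, and `β'(1)` is orthogonal to `∂A` at `z₀`"): `β` has derivative
`β' x` within `[0, 1]` at every `x ∈ [0, 1]`, `β'` is continuous on `[0, 1]` with `β'(1) ≠ 0`,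
`β(x) ∈ interior A` for `0 ≤ x < 1`, `β(1) = γ(s₀)`, and `β'(1) ⊥ γ'(s₀)`
(`Re (β'(1) · conj γ'(s₀)) = 0`, the tangent of the boundary arc at `z₀` being `γ'(s₀)`).
[cite: LawlerSchrammWerner2003Restriction, proof of Lemma 6.3 (the path β)] -/
def IsSmoothHitPath (A : Set ℂ) (γ γ' : ℝ → ℂ) (s₀ : ℝ) (β β' : ℝ → ℂ) : Prop :=
  (∀ x ∈ Icc (0 : ℝ) 1, HasDerivWithinAt β (β' x) (Icc 0 1) x) ∧ ContinuousOn β' (Icc 0 1) ∧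
    β' 1 ≠ 0 ∧ (∀ x ∈ Ico (0 : ℝ) 1, β x ∈ interior A) ∧ β 1 = γ s₀ ∧
    (β' 1 * conj (γ' s₀)).re = 0

namespace IsSmoothHitPath

variable {γ γ' β β' : ℝ → ℂ} {s₀ : ℝ}

/-- The path is continuous on `[0, 1]`. [folklore] -/
theorem continuousOn (h : IsSmoothHitPath A γ γ' s₀ β β') : ContinuousOn β (Icc 0 1) :=
  fun x hx ↦ (h.1 x hx).continuousWithinAt

/-- Before its endpoint the path runs in the interior of `A`. [folklore] -/
theorem mem_interior (h : IsSmoothHitPath A γ γ' s₀ β β') {x : ℝ} (hx : x ∈ Ico (0 : ℝ) 1) :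
    β x ∈ interior A :=
  h.2.2.2.1 x hx

/-- The endpoint is `z₀ = γ(s₀)`. [folklore] -/
theorem apply_one (h : IsSmoothHitPath A γ γ' s₀ β β') : β 1 = γ s₀ :=
  h.2.2.2.2.1

/-- **The points `β(x)`, `x < 1`, are still flowing at the hitting time**, so that
`Loewner.map W τ (β x)` is the honest value `g_T(β(x))`: interior points of a Jordan arc hull are
not swallowed by its hitting time (`Loewner.IsHullHitTime.lt_swallowingTime_of_mem_interior`).
[folklore] -/
theorem lt_swallowingTime {W : ℝ≥0 → ℝ} (hW : Continuous W) (hA : IsSmoothHullWith A γ γ')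
    {τ : ℝ≥0} (hτ : Loewner.IsHullHitTime W A τ)
    (hreal : ∀ x : ℝ, (x : ℂ) ∈ A → ¬ Loewner.swallowingTime W x ≤ (τ : WithTop ℝ≥0))
    (h : IsSmoothHitPath A γ γ' s₀ β β') {x : ℝ} (hx : x ∈ Ico (0 : ℝ) 1) :
    (τ : WithTop ℝ≥0) < Loewner.swallowingTime W (β x) :=
  hτ.lt_swallowingTime_of_mem_interior hW hA.isSmoothHull.isArcHull hreal (h.mem_interior hx)

end IsSmoothHitPath

/-! ### The two halves of the claim (named facts) -/

/-- NAMED FACT — **[LSW] proof of Lemma 6.3, the claim, limit part** (p. 14): in the setting of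
Lemma 6.3 (`W` continuous, `A ∈ 𝒬*` a smooth hull, `T < ∞` the hitting time of `A` by the closed
hulls `K_t`, `K_T ∩ A ∩ ℝ = ∅`), for `z₀ ∈ ∂A ∩ K_T` and a smooth path `β` with
`β[0,1) ⊂ interior A`, `β(1) = z₀`, `β'(1) ⊥ ∂A` at `z₀`: "As in the proof of Lemma 6.2, we know
that `lim_{x ↗ 1} β̂(x) = W_T`" for `β̂ = g_T ∘ β`, i.e. `g_T(β(x)) − W_T → 0` as `x ↗ 1`
(proof of Lemma 6.2: "the limit `w := lim_{s ↗ 1} g_T ∘ β(s)` exists. (This is because the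
image of the conformal map `g_T` is a smooth domain, i.e., `ℍ`. See, e.g., [Pommerenke].)
Moreover, since `β(1) = z₀`, we must have `w = W`. Otherwise, one easily gets a contradiction
to `z₀ ∈ K_T ∖ ⋃_{t<T} K_t`"). Here `z₀ = γ(s₀)` for the parametrisation `γ` of the boundary
arc, `g_T = Loewner.map W τ`, and `β(x)`, `x < 1`, is still flowing at time `τ`
(`IsSmoothHitPath.lt_swallowingTime`). [cite: LawlerSchrammWerner2003Restriction, proof of Lemma 6.3 (claim: lim β̂(x) = W_T), with proof of Lemma 6.2] -/
def IsSmoothHull.hitPath_tendsto : Prop :=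
  ∀ {W : ℝ≥0 → ℝ}, Continuous W → ∀ {A : Set ℂ} {γ γ' : ℝ → ℂ}, IsSmoothHullWith A γ γ' →
    IsStarHull A → ∀ {τ : ℝ≥0}, Loewner.IsHullHitTime W A τ →
      (∀ x : ℝ, (x : ℂ) ∈ A → ¬ Loewner.swallowingTime W x ≤ (τ : WithTop ℝ≥0)) →
    ∀ {s₀ : ℝ}, s₀ ∈ Ioo (0 : ℝ) 1 → γ s₀ ∈ Loewner.closedHull W τ →
    ∀ {β β' : ℝ → ℂ}, IsSmoothHitPath A γ γ' s₀ β β' →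
      Tendsto (fun x ↦ Loewner.map W τ (β x) - W τ) (𝓝[<] 1) (𝓝 0)

/-- NAMED FACT — **[LSW] proof of Lemma 6.3, the claim, sector part** (p. 14): in the same
setting, "`β̂(x) := g_T ∘ β(x) − W_T`, `x ∈ [0,1)`, is a path which is contained in a sector
`|Re z| ≤ c Im z` for some `c`" (proof in print: a planar Brownian motion from `β(x)` stopped on
`K_T ∪ ℝ` exits "to the right of `β[0,1]`" with probability bounded below, "because the
Brownian motion has probability bounded from below to first hit `D ∪ σ₁` on `σ₁` and from the
side of `σ₁` not in the interior of `A`", `σ₁, σ₂` the two arcs of `∂A ∩ D` at `z₀`; "By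
conformal invariance, this shows that Brownian motion started from `β̂(x)` has probability
bounded from below to first hit `ℝ` in `(0, ∞)`. Consequently, `Im β̂(x) ≥ −c Re β̂(x)` … The
symmetric argument also shows `Im β̂(x) ≥ c Re β̂(x)`"). Vocabulary as in
`IsSmoothHull.hitPath_tendsto`. [cite: LawlerSchrammWerner2003Restriction, proof of Lemma 6.3 (claim: β̂ ⊂ {|Re z| ≤ c Im z})] -/
def IsSmoothHull.hitPath_stolz : Prop :=
  ∀ {W : ℝ≥0 → ℝ}, Continuous W → ∀ {A : Set ℂ} {γ γ' : ℝ → ℂ}, IsSmoothHullWith A γ γ' →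
    IsStarHull A → ∀ {τ : ℝ≥0}, Loewner.IsHullHitTime W A τ →
      (∀ x : ℝ, (x : ℂ) ∈ A → ¬ Loewner.swallowingTime W x ≤ (τ : WithTop ℝ≥0)) →
    ∀ {s₀ : ℝ}, s₀ ∈ Ioo (0 : ℝ) 1 → γ s₀ ∈ Loewner.closedHull W τ →
    ∀ {β β' : ℝ → ℂ}, IsSmoothHitPath A γ γ' s₀ β β' →
      ∃ c : ℝ, ∀ x ∈ Ico (0 : ℝ) 1,
        |(Loewner.map W τ (β x) - W τ).re| ≤ c * (Loewner.map W τ (β x) - W τ).im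

end Literature.Probability.RandomPlanarGeometry
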